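import Mathlib
import Summits.ValiantsHypothesis.ValiantsHypothesis.Theses.LiouvilleSarnak
import Summits.ValiantsHypothesis.ValiantsHypothesis.Theorems.LiouvilleSarnakLiouvilleCutRankUpperEntropy

/-!
# Route LiouvilleSarnak — crux `LiouvilleCutRank` (stmt-ValiantsHypothesis-14775):
# the hierarchy of sufficient hypotheses is formal

The tree now holds two chains of conditional bridges for the crux:
Chowla ⇒ all sign patterns occur (`ChowlaPatterns.signPatterns_of_chowla`) ⇒ crux
(`SignPatterns.liouvilleCutRank_of_signPatterns`), and
Sarnak ⇒ positive sign-pattern entropy (`SarnakBridge.patternEntropy_of_sarnak`) ⇒ crux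
(`BlockEntropy.liouvilleCutRank_of_patternEntropy` / `…_of_upperPatternEntropy`).
This file checks that the entropy criterion SUBSUMES the sign-pattern one:

* `patternEntropy_of_signPatterns` — if every finite sign pattern occurs in `λ`, then `λ` has (maximal)
  sign-pattern entropy: for every `L` some `M` sees all `2^L` windows, so `2^{1·L} ≤ #windows`.
(Composing with `liouvilleCutRank_of_patternEntropy` re-derives the tree's
`SignPatterns.liouvilleCutRank_of_signPatterns`; not restated here.)

Honest framing: bookkeeping between OPEN hypotheses; `LiouvilleCutRank`, `DigitalBilinearLiouville`,
`AlgebraicSarnak` stay OPEN; nothing here bears on VP versus VNP.  No definitions.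
-/

-- the directory `ValiantsHypothesis/ValiantsHypothesis` repeats the summit name (tree layout)
set_option linter.dupNamespace false

namespace Summit.ValiantsHypothesis.ValiantsHypothesis.Theorems.LiouvilleSarnakLiouvilleCutRank.BlockEntropy

open Finset ArithmeticFunction

open Summit.ValiantsHypothesis.ValiantsHypothesis.Theses.LiouvilleSarnak (LiouvilleCutRank)

/-- **All sign patterns ⇒ maximal sign-pattern entropy.**  If every finite sign pattern occurs in the
Liouville sequence, then for every `L` some initial segment of positions shows all `2^L` windows
`(λ(m+1), …, λ(m+L))`, so the entropy hypothesis of `liouvilleCutRank_of_patternEntropy` holds with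
`η = 1`. [folklore] -/
theorem patternEntropy_of_signPatterns
    (hpat : ∀ k : ℕ, ∀ p : Fin k → Bool, ∃ m : ℕ, ∀ i : Fin k,
      liouville (m + i + 1) = if p i then 1 else -1) :
    ∃ η : ℝ, 0 < η ∧ ∃ L₀ : ℕ, ∀ L : ℕ, L₀ ≤ L → ∃ M : ℕ, (2 : ℝ) ^ (η * L) ≤
      ((range M).image fun m : ℕ => fun j : Fin L => (liouville (m + j + 1) : ℤ)).card := by
  classical
  refine ⟨1, one_pos, 0, fun L _ => ?_⟩
  -- a position for every pattern, and a common bound `M`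
  choose m hm using hpat L
  set M : ℕ := (univ : Finset (Fin L → Bool)).sup m + 1
  refine ⟨M, ?_⟩
  -- the `2^L` sign vectors of the patterns are distinct windows below `M`
  let v : (Fin L → Bool) → (Fin L → ℤ) := fun p j => if p j then 1 else -1
  have hv : Function.Injective v := by
    intro p q hpq
    funext j
    have h := congrFun hpq j
    simp only [v] at h
    by_cases hp : p j <;> by_cases hq : q j <;> simp_all
  have hsub : (univ : Finset (Fin L → Bool)).image v ⊆
      (range M).image fun m : ℕ => fun j : Fin L => (liouville (m + j + 1) : ℤ) := by
    intro w hw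
    obtain ⟨p, -, rfl⟩ := mem_image.mp hw
    refine mem_image.mpr ⟨m p, mem_range.mpr ?_, ?_⟩
    · have : m p ≤ (univ : Finset (Fin L → Bool)).sup m := le_sup (mem_univ p)
      omega
    · funext j
      exact hm p j
  have hcard : 2 ^ L ≤ ((range M).image fun m : ℕ => fun j : Fin L =>
      (liouville (m + j + 1) : ℤ)).card := by
    calc 2 ^ L = ((univ : Finset (Fin L → Bool)).image v).card := by
          rw [card_image_of_injective _ hv, card_univ, Fintype.card_fun, Fintype.card_fin,
            Fintype.card_bool]
      _ ≤ _ := card_le_card hsub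
  rw [one_mul, Real.rpow_natCast]
  exact_mod_cast hcard

end Summit.ValiantsHypothesis.ValiantsHypothesis.Theorems.LiouvilleSarnakLiouvilleCutRank.BlockEntropy
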